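import Literature.AlgebraicGeometry.Resolution.LocalUniformizationAbhyankarPlacesProofs
import Literature.AlgebraicGeometry.Resolution.AbhyankarBases
import Literature.AlgebraicGeometry.Resolution.KnafKuhlmann2005Thm34Stability
import HarnessLib

/-!
# Crux `Steer` (stmt-ResolutionOfSingularities-16345), chain W4.1: a DENSE-ABHYANKAR valuation has a finitely
# generated value group and a finitely generated residue field (N2(c) certificate, Theses-free)

OURS (campaign `res-hironaka`, rung L, slot W4.1, chain W4.1; replaces the role of no printed item; NOT a
statement of the manuscript under review; AI review is weaker than expert review). CHAIN W4.1 v5.4 §B3 (ii)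
adopts as CORE CERTIFICATE for a valuation the rule N2(c): «value group not f.g. (or residue field not f.g.
over `k`) ⇒ `¬ DenseAbhyankar`» — the contrapositive of what this file PROVES about the line's predicate
`DenseAbhyankar k O` (`Cruxes/Steer/Lines/switching_dichotomy.lean`, UNFOLDED verbatim here as a hypothesis:
`K` is dense in a finitely generated subfield `F₀ ⊇ k` on which `O` is an Abhyankar place of `F₀|k`):

* `exists_valuation_eq_prod_zpow` — **elementwise value certificate**: there are finitely many
  `x₁, …, x_ρ ∈ K^×` such that EVERY value `v(z)`, `z ∈ K^×`, is a monomial `∏ v(xᵢ)^{mᵢ}`, `m ∈ ℤ^ρ`;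
* `valueGroup_fg` — hence the value group `|K^×| = (ValueGroup O)ˣ` is a finitely generated group;
* `residueField_fg` — the residue field of `O` is finitely generated over `k` (as a field).

Proof. DENSITY makes `K|F₀` immediate: for `z ≠ 0` some `a ∈ F₀` has `v(z − a) < v(z)`, so
`v(z) = v(a)` (`exists_mem_valuation_eq_of_dense`), and every residue of `O` is the residue of an element
of `O ∩ F₀` (`residueFieldComapAlgHom_surjective_of_dense`). On the finitely generated `F₀|k` with its
ABHYANKAR place: Knaf–Kuhlmann 2005 Thm. 2.1 (tree `exists_valuation_eq_of_mem_closure`: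
`vK(x,y) = vK ⊕ ⊕ ℤ v(xᵢ)`) applied to the ADAPTED Abhyankar basis of the tree's `exists_abhyankarData`
(Temkin 2013 Thm. 5.5.1 (iii): the values of `x` generate the value group of `F₀`) gives the monomials, the
trivially valued `k` contributing `v = 1`; and Temkin 2013 Remark 2.1.3 (tree
`residueField_fg_of_isTranscendenceBasis` on an Abhyankar basis from `exists_isAbhyankarBasis`, with
`D = 0` by `transcendenceDefect_comap_eq_zero_of_isAbhyankarPlace`) gives the finite generation of the
residue field of `O ∩ F₀`, transported to `O` along the surjective residue map and from the base
`k ≅ (algebraMap k K).fieldRange` to `k`. [cite: KnafKuhlmann2005, Thm. 2.1]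
[cite: Temkin2013, Remark 2.1.3 (p. 10 of arXiv:0804.1554v3)] [folklore]
-/

noncomputable section

-- `Summit.<S>.<S>.…` duplicates the summit name by design (single-problem summit).
set_option linter.dupNamespace false

open IsLocalRing ValuationSubring

namespace Summit.ResolutionOfSingularities.ResolutionOfSingularities.Theorems.SwitchingDichotomy

open Literature.AlgebraicGeometry.Resolution

namespace DenseAbhyankarFG

variable {k K : Type} [Field k] [Field K] [Algebra k K]

/-! ## Density: `K|F₀` is immediate -/

/-- **Density gives the same values**: if every `x ∈ K` is approximated by elements of `F₀` to within any
non-zero value, then every non-zero `z ∈ K` has the value of a non-zero element of `F₀` (take `a ∈ F₀` with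
`v(z − a) < v(z)`). [folklore] -/
theorem exists_mem_valuation_eq_of_dense (O : ValuationSubring K) {F₀ : Subfield K}
    (hd : ∀ x w : K, w ≠ 0 → ∃ a ∈ F₀, O.valuation (x - a) < O.valuation w) {z : K} (hz : z ≠ 0) :
    ∃ a ∈ F₀, a ≠ 0 ∧ O.valuation z = O.valuation a := by
  obtain ⟨a, haF, ha⟩ := hd z z hz
  have hza : O.valuation a = O.valuation z := by
    rw [← Valuation.map_neg _ (z - a), neg_sub] at ha
    exact Valuation.map_eq_of_sub_lt _ ha
  refine ⟨a, haF, fun h => hz ?_, hza.symm⟩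
  rw [h, map_zero] at hza
  exact (map_eq_zero O.valuation).mp hza.symm

/-- **Density gives the same residues**: with `F₀` dense in `K`, every element of `O` is congruent modulo
`𝔪_O` to an element of `O ∩ F₀` (take `a ∈ F₀` with `v(x − a) < v(1) = 1`). [folklore] -/
theorem exists_mem_valuation_sub_lt_one_of_dense (O : ValuationSubring K) {F₀ : Subfield K}
    (hd : ∀ x w : K, w ≠ 0 → ∃ a ∈ F₀, O.valuation (x - a) < O.valuation w) (x : O) :
    ∃ a : O, (a : K) ∈ F₀ ∧ residue O x = residue O a := by
  obtain ⟨a, haF, ha⟩ := hd (x : K) 1 one_ne_zero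
  rw [map_one] at ha
  have haO : a ∈ O := by
    rw [← O.valuation_le_one_iff]
    have h1 : a = (x : K) - ((x : K) - a) := by ring
    rw [h1]
    refine (O.valuation.map_sub _ _).trans (max_le ((O.valuation_le_one_iff _).mpr x.2) ha.le)
  refine ⟨⟨a, haO⟩, haF, ?_⟩
  rw [← sub_eq_zero, ← map_sub, residue_eq_zero_iff, valuation_lt_one_iff]
  exact ha

/-! ## The value group -/

/-- **Elementwise value certificate of a dense-Abhyankar valuation** (N2(c), values): if `k ⊆ O` and `K`
is dense in a finitely generated subfield `F₀ ⊇ k` on which `O` is an Abhyankar place of `F₀|k` (the line's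
`DenseAbhyankar k O`, unfolded), then there are `x₁, …, x_ρ ∈ K^×` such that every value of `K^×` is a
monomial `v(z) = ∏ v(xᵢ)^{mᵢ}`, `m ∈ ℤ^ρ` (Knaf–Kuhlmann 2005 Thm. 2.1 on an adapted Abhyankar basis of
`F₀|k`, plus density). [cite: KnafKuhlmann2005, Thm. 2.1] [cite: Temkin2013, Remark 2.1.3 (p. 10 of
arXiv:0804.1554v3)] -/
theorem exists_valuation_eq_prod_zpow (O : ValuationSubring K) (hk : ∀ c : k, algebraMap k K c ∈ O)
    (hD : ∃ F₀ : Subfield K, (algebraMap k K).fieldRange ≤ F₀ ∧ FGOver (algebraMap k K).fieldRange F₀ ∧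
      IsAbhyankarPlace O (algebraMap k K).fieldRange F₀ ∧
      ∀ x w : K, w ≠ 0 → ∃ a ∈ F₀, O.valuation (x - a) < O.valuation w) :
    ∃ (ρ : ℕ) (x : Fin ρ → K), (∀ i, x i ≠ 0) ∧
      ∀ z : K, z ≠ 0 → ∃ m : Fin ρ → ℤ, O.valuation z = ∏ i, O.valuation (x i) ^ (m i) := by
  classical
  obtain ⟨F₀, -, hfg, hA, hd⟩ := hD
  set k' : Subfield K := (algebraMap k K).fieldRange with hk'
  have hkV : (k' : Set K) ⊆ O := by
    rintro _ ⟨c, rfl⟩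
    exact hk c
  obtain ⟨ρ, τ, x, y, hy, hx, -, hxi, hri, -, -, hval⟩ := exists_abhyankarData O k' F₀ hfg hkV hA
  refine ⟨ρ, x, fun i => (hx i).2, fun z hz => ?_⟩
  -- `v(z) = v(a)`, `a ∈ F₀`; `v(a) = v(w)`, `w ∈ k(x, y)`
  obtain ⟨a, haF, ha0, hza⟩ := exists_mem_valuation_eq_of_dense O hd hz
  obtain ⟨w, hwL, haw⟩ := hval a haF ha0
  have hw0 : w ≠ 0 := by
    intro h
    rw [h, map_zero, map_eq_zero] at haw
    exact ha0 haw
  have hwL' : w ∈ Subfield.closure ((k' : Set K) ∪ (Set.range x ∪ Set.range y)) :=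
    (mem_adjoin_subfield_iff k' _ w).mp hwL
  -- Knaf–Kuhlmann 2005, Thm. 2.1: `v(w) = v(b) · ∏ v(xᵢ)^{mᵢ}` with `b ∈ k`, `v(b) = 1`
  obtain ⟨m, b, hbk, hwb⟩ :=
    exists_valuation_eq_of_mem_closure O k' (fun i => (hx i).2) hxi hy hri hwL' hw0
  have hb0 : b ≠ 0 := by
    rintro rfl
    rw [map_zero, zero_mul, map_eq_zero] at hwb
    exact hw0 hwb
  have hb1 : O.valuation b = 1 := valuation_eq_one_of_subfield_subset O (fun z hz => hkV hz) hbk hb0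
  refine ⟨m, ?_⟩
  rw [hza, haw, hwb, hb1, one_mul]

/-- **The value group of a dense-Abhyankar valuation is finitely generated** (N2(c), group form): under
the hypotheses of `exists_valuation_eq_prod_zpow`, `|K^×| = (ValueGroup O)ˣ` is a finitely generated group
(generated by the values `v(xᵢ)`). [cite: KnafKuhlmann2005, Thm. 2.1] [cite: Temkin2013, Remark 2.1.3
(p. 10 of arXiv:0804.1554v3)] -/
theorem valueGroup_fg (O : ValuationSubring K) (hk : ∀ c : k, algebraMap k K c ∈ O)
    (hD : ∃ F₀ : Subfield K, (algebraMap k K).fieldRange ≤ F₀ ∧ FGOver (algebraMap k K).fieldRange F₀ ∧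
      IsAbhyankarPlace O (algebraMap k K).fieldRange F₀ ∧
      ∀ x w : K, w ≠ 0 → ∃ a ∈ F₀, O.valuation (x - a) < O.valuation w) :
    Group.FG (ValuationSubring.ValueGroup O)ˣ := by
  classical
  obtain ⟨ρ, x, hx0, hval⟩ := exists_valuation_eq_prod_zpow O hk hD
  let g : Fin ρ → (ValuationSubring.ValueGroup O)ˣ := fun i =>
    Units.mk0 (O.valuation (x i)) (valuation_ne_zero_of_ne_zero O (hx0 i))
  refine ⟨⟨Finset.univ.image g, ?_⟩⟩
  rw [Finset.coe_image, Finset.coe_univ, Set.image_univ, _root_.eq_top_iff]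
  rintro γ -
  -- `γ = v(z)` for some `z ≠ 0`
  obtain ⟨z, hz⟩ := O.valuation_surjective (γ : ValuationSubring.ValueGroup O)
  have hz0 : z ≠ 0 := fun h => by
    rw [h, map_zero] at hz
    exact γ.ne_zero hz.symm
  obtain ⟨m, hm⟩ := hval z hz0
  have hγ : γ = ∏ i, g i ^ (m i) := by
    apply Units.ext
    rw [← hz, hm, Units.coe_prod]
    refine Finset.prod_congr rfl fun i _ => ?_
    rw [Units.val_zpow_eq_zpow_val, Units.val_mk0]
  rw [hγ]
  exact Subgroup.prod_mem _ fun i _ =>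
    Subgroup.zpow_mem _ (Subgroup.subset_closure (Set.mem_range_self i)) _

/-! ## The residue field -/

/-- With `F₀` dense in `K`, the residue map `κ(O ∩ M) → κ(O)` of an intermediate field `M` with the same
elements as `F₀` is surjective. [folklore] -/
theorem residueFieldComapAlgHom_surjective_of_dense {k' : Type} [Field k'] [Algebra k' K]
    (O : ValuationSubring K) (hk' : ∀ c : k', algebraMap k' K c ∈ O)
    (M : IntermediateField k' K) (hkM : ∀ c : k', algebraMap k' M c ∈ O.comap (algebraMap M K))
    {F₀ : Subfield K} (hMF : ∀ z, z ∈ M ↔ z ∈ F₀)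
    (hd : ∀ x w : K, w ≠ 0 → ∃ a ∈ F₀, O.valuation (x - a) < O.valuation w) :
    letI := algebraOfMem k' O hk'
    letI := algebraOfMem k' (O.comap (algebraMap M K)) hkM
    Function.Surjective (residueFieldComapAlgHom k' O hk' hkM) := by
  letI := algebraOfMem k' O hk'
  letI := algebraOfMem k' (O.comap (algebraMap M K)) hkM
  intro r
  obtain ⟨x, rfl⟩ := IsLocalRing.residue_surjective r
  obtain ⟨a, haF, hxa⟩ := exists_mem_valuation_sub_lt_one_of_dense O hd x
  refine ⟨residue _ ⟨⟨(a : K), (hMF _).mpr haF⟩, ValuationSubring.mem_comap.mpr a.2⟩, ?_⟩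
  rw [residueFieldComapAlgHom_residue, hxa]
  rfl

/-- **The residue field of a dense-Abhyankar valuation is finitely generated over the constants**, base
rendered as the subfield `k' = (algebraMap k K).fieldRange` (N2(c), residues; Temkin 2013 Remark 2.1.3 on
an Abhyankar basis of `F₀|k`, plus density). [cite: Temkin2013, Remark 2.1.3 (p. 10 of arXiv:0804.1554v3)]
[cite: KnafKuhlmann2005, Thm. 2.1] -/
theorem residueField_fg_fieldRange (O : ValuationSubring K) (hk : ∀ c : k, algebraMap k K c ∈ O)
    (hD : ∃ F₀ : Subfield K, (algebraMap k K).fieldRange ≤ F₀ ∧ FGOver (algebraMap k K).fieldRange F₀ ∧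
      IsAbhyankarPlace O (algebraMap k K).fieldRange F₀ ∧
      ∀ x w : K, w ≠ 0 → ∃ a ∈ F₀, O.valuation (x - a) < O.valuation w)
    (hk' : ∀ c : (algebraMap k K).fieldRange, algebraMap (algebraMap k K).fieldRange K c ∈ O) :
    letI := algebraOfMem (algebraMap k K).fieldRange O hk'
    (⊤ : IntermediateField (algebraMap k K).fieldRange (ResidueField O)).FG := by
  classical
  obtain ⟨F₀, -, hfg, hA, hd⟩ := hD
  set k' : Subfield K := (algebraMap k K).fieldRange with hk'def
  have hkV : (k' : Set K) ⊆ O := by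
    rintro _ ⟨c, rfl⟩
    exact hk c
  letI := algebraOfMem k' O hk'
  haveI := isScalarTower_algebraOfMem k' O hk'
  -- `F₀` as an intermediate field `M` of `K|k'`, `O_M := O ∩ M`
  obtain ⟨s₀, hs₀⟩ := hfg
  set M : IntermediateField k' K := IntermediateField.adjoin k' (s₀ : Set K) with hM
  have hMF : ∀ z : K, z ∈ M ↔ z ∈ F₀ := fun z => by
    rw [hM, mem_adjoin_subfield_iff, hs₀]
  have hfgM : (⊤ : IntermediateField k' M).FG :=
    IntermediateField.fg_top_iff.mpr
      (IntermediateField.essFiniteType_iff.mpr (IntermediateField.fg_adjoin_finset s₀))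
  have hkM : ∀ c : k', algebraMap k' M c ∈ O.comap (algebraMap M K) :=
    algebraMap_mem_comap_intermediateField O M hkV
  set OM := O.comap (algebraMap M K) with hOM
  have hDM : transcendenceDefect k' OM hkM = 0 :=
    transcendenceDefect_comap_eq_zero_of_isAbhyankarPlace O M hMF hkV hfgM hA
  letI := algebraOfMem k' OM hkM
  haveI := isScalarTower_algebraOfMem k' OM hkM
  -- an Abhyankar basis of `(M, O_M)`; its residue field is finitely generated over `k'`
  obtain ⟨E, F, x, y, hB⟩ := exists_isAbhyankarBasis OM hkM hfgM hDM
  obtain ⟨-, hfgres⟩ := residueField_fg_of_isTranscendenceBasis OM y x hfgM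
    hB.algebraicIndependent_residue hB.ne_zero hB.linearIndependent hB.isTranscendenceBasis
  -- transport along the surjective residue map `κ(O_M) → κ(O)`
  let φ := residueFieldComapAlgHom k' O hk' hkM
  have hφ : Function.Surjective φ := residueFieldComapAlgHom_surjective_of_dense O hk' M hkM hMF hd
  obtain ⟨S, hS⟩ := hfgres
  refine ⟨S.image φ, ?_⟩
  rw [Finset.coe_image, ← IntermediateField.adjoin_map, hS, _root_.eq_top_iff]
  rintro r -
  obtain ⟨r', rfl⟩ := hφ r
  exact ⟨r', IntermediateField.mem_top, rfl⟩

/-- **The residue field of a dense-Abhyankar valuation is finitely generated over `k`** (N2(c), residues):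
if `k ⊆ O` and `K` is dense in a finitely generated subfield `F₀ ⊇ k` on which `O` is an Abhyankar place of
`F₀|k` (the line's `DenseAbhyankar k O`, unfolded), then the residue field of `O` is a finitely generated
field extension of `k` (for the `k`-algebra structure `algebraOfMem k O hk`).
[cite: Temkin2013, Remark 2.1.3 (p. 10 of arXiv:0804.1554v3)] [cite: KnafKuhlmann2005, Thm. 2.1] -/
theorem residueField_fg (O : ValuationSubring K) (hk : ∀ c : k, algebraMap k K c ∈ O)
    (hD : ∃ F₀ : Subfield K, (algebraMap k K).fieldRange ≤ F₀ ∧ FGOver (algebraMap k K).fieldRange F₀ ∧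
      IsAbhyankarPlace O (algebraMap k K).fieldRange F₀ ∧
      ∀ x w : K, w ≠ 0 → ∃ a ∈ F₀, O.valuation (x - a) < O.valuation w) :
    letI := algebraOfMem k O hk
    (⊤ : IntermediateField k (ResidueField O)).FG := by
  classical
  set k' : Subfield K := (algebraMap k K).fieldRange with hk'def
  have hk' : ∀ c : k', algebraMap k' K c ∈ O := by
    rintro ⟨_, c, rfl⟩
    exact hk c
  have h := residueField_fg_fieldRange O hk hD hk'
  letI i₁ := algebraOfMem k O hk
  letI i₂ := algebraOfMem k' O hk'
  obtain ⟨S, hS⟩ := h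
  refine ⟨S, ?_⟩
  -- the two base fields have the same image in the residue field
  have e₁ : ∀ c : k, algebraMap k (ResidueField O) c = residue O ⟨algebraMap k K c, hk c⟩ := fun c => by
    rw [IsScalarTower.algebraMap_apply k O (ResidueField O), IsLocalRing.ResidueField.algebraMap_eq]
    rfl
  have e₂ : ∀ c : k', algebraMap k' (ResidueField O) c = residue O ⟨(c : K), hk' c⟩ := fun c => by
    rw [IsScalarTower.algebraMap_apply k' O (ResidueField O), IsLocalRing.ResidueField.algebraMap_eq]
    rfl
  have hrange : Set.range (algebraMap k (ResidueField O)) =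
      Set.range (algebraMap k' (ResidueField O)) := by
    ext r
    constructor
    · rintro ⟨c, rfl⟩
      refine ⟨⟨algebraMap k K c, c, rfl⟩, ?_⟩
      rw [e₁, e₂]
    · rintro ⟨c, rfl⟩
      obtain ⟨c₀, hc₀⟩ := RingHom.mem_fieldRange.mp c.2
      refine ⟨c₀, ?_⟩
      rw [e₁, e₂]
      exact congrArg _ (Subtype.ext hc₀)
  have h1 : (IntermediateField.adjoin k (S : Set (ResidueField O))).toSubfield =
      (IntermediateField.adjoin k' (S : Set (ResidueField O))).toSubfield := by
    rw [IntermediateField.adjoin_toSubfield, IntermediateField.adjoin_toSubfield, hrange]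
  apply IntermediateField.toSubfield_injective
  rw [h1, hS, IntermediateField.top_toSubfield, IntermediateField.top_toSubfield]

end DenseAbhyankarFG

end Summit.ResolutionOfSingularities.ResolutionOfSingularities.Theorems.SwitchingDichotomy

end
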